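import Literature.IUT.HodgeTheaters.GoodLocalFrobenioidSigmaLift
import Literature.AlgebraicGeometry.Frobenioids.PadicFrobenioidPrimMulTransport
import Literature.AlgebraicGeometry.Frobenioids.PadicFrobenioidSplittingTransport
import HarnessLib

/-!
# [IUTchI] Ex 3.3 (i) / Cor 5.3 (iii) at the genuine good place — the MONO-ANALYTIC lift: a topological automorphism `β` of
# `G_v = Gal(K̄_v/K_v)` together with a `β⁻¹`-equivariant integral multiplicative `σ : K̄_vˣ ⥲ K̄_vˣ` of the same valuation at `p`
# lifts to a self-equivalence of the genuine split Frobenioid `ℱ⊢_v = (𝒞⊢_v, τ⊢_v)` lying over `pull β` (abc-iut-L5-t16, row R77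
# «COR53III-GOOD-SLOT@GENUINE»; the `⊢`-twin of abc-iut-w4-d047's `GoodLocalFrobenioidSigmaLift`)

S. Mochizuki, *Inter-universal Teichmüller theory I*, kurims manuscript (May 2020), §3 Example 3.3 (i) p. 78 («`Φ_{𝒞⊢_v} : Spec(L) ↦
ord(ℤ^▷_{p_v})`»; «Write `ℱ⊢_v := (𝒞⊢_v, τ⊢_v)` for the resulting split Frobenioid»), §5 Corollary 5.3 (iii) p. 144 («the natural map
`Isom(¹𝔉⊢, ²𝔉⊢) → Isom(¹𝔇⊢, ²𝔇⊢)` [cf. Remark 5.2.1, (i)] is surjective»; proof p. 144: (iii) «follows immediately from […] [AbsTopIII],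
Proposition 5.8, (ii), (v)») ([IUTchI] Cor 5.3 (iii) p.144) [claim: Mochizuki2012, status: disputed] (D-0012 claim key; CONSTRUCTIONS and
PROOFS over landed files; nothing of the series is asserted; no side is taken on [IUTchIII] Cor. 3.12).  *The geometry of Frobenioids I*,
Cor. 5.4 p. 104 [cite: MochizukiFrdI2008, Cor. 5.4 p.104]; *The geometry of Frobenioids II*, Ex. 1.1 (ii) p. 8, Thm. 1.2 (v) p. 9
[cite: MochizukiFrdII2008, Ex 1.1 (ii) p.8].

## What this file proves (cell abc-iut, L5 HUB node `IUTchI:Cor5.3(iii)`, GOOD NONARCHIMEDEAN `⊢`-SLOT; the `⊢`-twin of ★ `SigmaLift`)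

At abc-iut-L5-t2's REAL `GoodLocalFrobenioid.ofGalois d aug …` the mono-analytic Frobenioid `𝒞⊢_v` IS `(Datum.prim d.fieldFunctor …).frobenioid`
over `𝒟⊢_v = CosetCat G_v` (`ofGalois_bases`, `ofKit_C` — rfl) — it does not see `Π_v`/`aug` at all.  For a MULTIPLICATIVE `σ : Ωˣ ⥲ Ωˣ`
(`Ω = K̄_v`) with `σ (γ • x) = β⁻¹ γ • σ x`, `v(x) ≤ 1 → v(σ x) ≤ 1` and `v(σ p) = v(p)` — which abc-iut-w4-d047's `MLFSigma.sigma` (L4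
`Prop121vii.unitsTransport_holds`, [AbsAnab] Prop 1.2.1 (vi)) produces for EVERY topological automorphism `β` of `G_v` — fed through
abc-iut-L5-t16's L1 brick `PadicFrd.primMulTransport` (the `p`-NORMALISED transport: `σ` on `𝒪^×`, the identity on `p^ℤ`):
* §A `DashSigmaLift.sigma_mem_fixedFld` (`σ` maps `(Ω^U)ˣ` into `Ω^{β⁻¹U}`), `tau` (the family `τ_X = σ|`), `tau_integral`, `tau_natural`
  (along `f : X' ⟶ X`, point `β w · U`: both composites are `u ↦ w • σ u`), `valuation_fixedFld_eq_iff`, `tau_p` (`v(τ_X p) = v(p)`);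
* §B `DashSigmaLift.dataHomOver` — `primMulTransport` at `F₁ := d.fieldFunctor`, `F₂ := pull β ⋙ d.fieldFunctor` over `CosetCat G_v`: a
  `ModelFrobenioid.DataHomOver (pull β)` between `𝒞⊢_v`'s OWN data (rfl);
* §C `DashSigmaLift.lift`, `lift_comp_CdashBase` (ON THE NOSE over `pull β`), `lift_isEquivalence` (bijective components from `σ⁻¹`),
  **`exists_selfEquivalence_liesUnder_pullSelfEquiv`** — for EVERY such `(β, σ)`: a self-equivalence of `𝒞⊢_v` (functor THE lift) lying under
  `pullSelfEquiv β β⁻¹` through `CdashBase`; and the same AT abc-iut-L5-t2's record, `exists_selfEquivalence_liesUnder_ofGalois` (any `Π_v ↠ G_v`);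
* §D **`map_pSplittingSubmonoid_lift`** — THE LIFT CARRIES `τ⊢_v` ONTO `τ⊢_v` (`(τ_p A).map (lift.mapEnd A) = τ_p (lift A)`, by the brick's
  `p̂ ↦ p̂` and abc-iut-L5-t16 gen 7's `map_pSplittingSubmonoid_eq_of_units`), i.e. the lift is an automorphism of the SPLIT Frobenioid `ℱ⊢_v`:
  `tauDash.IsPreservedBy tauDash lift` at abc-iut-L5-t2's record (`isPreservedBy_tauDash_lift`).
Binders (displayed): `d`, `β` (`hβc hβc'`), `σ`, `hσ`, `hσint`, `hσp` (+ the inverse family `σ'`); 0 instance · 0 notation · no `Prop` fact; defs: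
`tau`, `dataHomOver`, `lift`, `tau'`, `primDatum` (abbrev).  Print's Cor 5.3 (iii) asserts SURJECTIVITY only (spec of record, abc-iut-L5-lead
RULINGS #143 (2)); this file supplies lifts and claims no rigidity.  HONEST FRAMING: OUR transport of OUR datum; nothing here asserts abc proved or refuted.
-/

noncomputable section

namespace Literature.IUT.HodgeTheaters

open CategoryTheory Opposite Literature.AnabelianGeometry.SemiGraphs Literature.AlgebraicGeometry.Frobenioids
open scoped ValuativeRel

namespace DashSigmaLift

universe u

/-! ### §A. `σ` restricted to the fixed fields: the family `τ` over `CosetCat G_v` along `pull β` -/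

section Tau

variable {p : ℕ} [Fact p.Prime] (d : GaloisValDatum.{u} p) (β : d.Gal ≃* d.Gal) (hβc : Continuous β)
  (σ : d.Ωˣ →* d.Ωˣ) (hσ : ∀ (γ : d.Gal) (x : d.Ωˣ), σ (γ • x) = β.symm γ • σ x)
  (hσint : ∀ x : d.Ωˣ, ValuativeRel.valuation d.Ω (x : d.Ω) ≤ 1 → ValuativeRel.valuation d.Ω (σ x : d.Ω) ≤ 1)
  (hσp : ∀ x : d.Ωˣ, (x : d.Ω) = (p : ℕ) → ValuativeRel.valuation d.Ω (σ x : d.Ω) = ValuativeRel.valuation d.Ω ((p : ℕ) : d.Ω))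

/-- The base functor of `𝒞⊢_v`'s datum: `G_v/U ↦ Ω^U` (abc-iut-L5-t2's field functor). [cite: Mochizuki2012, I Ex 3.3 (i) p.78] -/
abbrev baseFunctor₁ : CosetCat d.Gal ⥤ PadicFrd.PadicFld.{u} p := d.fieldFunctor

/-- The same precomposed with `pull β`: `G_v/U ↦ Ω^{β⁻¹U}`. [cite: Mochizuki2012, I Ex 3.3 (i) p.78] -/
abbrev baseFunctor₂ : CosetCat d.Gal ⥤ PadicFrd.PadicFld.{u} p := CosetCat.pull (β : d.Gal →* d.Gal) hβc β.surjective ⋙ d.fieldFunctor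

include hσ in
/-- `σ` maps the units of `Ω^U` into `Ω^{β⁻¹U}`: for `g ∈ β⁻¹U`, `σ x = σ (β g • x) = g • σ x`. [cite: Mochizuki2012, I Ex 3.3 (i) p.78] -/
theorem sigma_mem_fixedFld (X : CosetCat d.Gal) (u : (↥(d.fixedFld X))ˣ) :
    (σ (SigmaLift.unitsVal d (d.fixedFld X) u) : d.Ω) ∈ d.fixedFld ((CosetCat.pull (β : d.Gal →* d.Gal) hβc β.surjective).obj X) := by
  refine (IntermediateField.mem_fixedField_iff _ _).mpr fun g hg => ?_
  have hg' : β g ∈ X.sg := hg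
  have hfix : β g • (SigmaLift.unitsVal d (d.fixedFld X) u) = SigmaLift.unitsVal d (d.fixedFld X) u := by
    apply Units.ext
    change (β g) ((u : ↥(d.fixedFld X)) : d.Ω) = _
    exact (IntermediateField.mem_fixedField_iff _ _).mp (u : ↥(d.fixedFld X)).2 _ hg'
  have key := hσ (β g) (SigmaLift.unitsVal d (d.fixedFld X) u)
  rw [hfix, MulEquiv.symm_apply_apply] at key
  exact (congrArg (fun w : d.Ωˣ => (w : d.Ω)) key).symm

/-- **The family `τ_X = σ|` of multiplicative maps `(Ω^U)ˣ → (Ω^{β⁻¹U})ˣ`** fed to the brick `primMulTransport`. [cite: Mochizuki2012, I Ex 3.3 (i) p.78] -/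
def tau (X : CosetCat d.Gal) : ((baseFunctor₁ d).obj X).Kˣ →* ((baseFunctor₂ d β hβc).obj X).Kˣ :=
  SigmaLift.fixedUnitsMap d σ _ _ (sigma_mem_fixedFld d β hβc σ hσ X)

/-- `τ_X` read in `Ωˣ` is `σ`. [cite: Mochizuki2012, I Ex 3.3 (i) p.78] -/
theorem unitsVal_tau (X : CosetCat d.Gal) (u : ((baseFunctor₁ d).obj X).Kˣ) :
    SigmaLift.unitsVal d (d.fixedFld ((CosetCat.pull (β : d.Gal →* d.Gal) hβc β.surjective).obj X)) (tau d β hβc σ hσ X u) =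
      σ (SigmaLift.unitsVal d (d.fixedFld X) u) :=
  Units.ext rfl

include hσint in
/-- `τ` carries integral units to integral units (the valuation of a fixed field is the restricted one). [cite: MochizukiFrdII2008, Ex 1.1 (i) p.7] -/
theorem tau_integral (X : CosetCat d.Gal) (u : ((baseFunctor₁ d).obj X).Kˣ)
    (hu : ValuativeRel.valuation ((baseFunctor₁ d).obj X).K (u : ((baseFunctor₁ d).obj X).K) ≤ 1) :
    ValuativeRel.valuation ((baseFunctor₂ d β hβc).obj X).K (tau d β hβc σ hσ X u : ((baseFunctor₂ d β hβc).obj X).K) ≤ 1 := by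
  have hu' : ValuativeRel.valuation d.Ω ((SigmaLift.unitsVal d (d.fixedFld X) u : d.Ωˣ) : d.Ω) ≤ 1 :=
    (SigmaLift.valuation_fieldObj_le_one_iff d X (Units.val u)).mp hu
  exact (SigmaLift.valuation_fieldObj_le_one_iff d ((CosetCat.pull (β : d.Gal →* d.Gal) hβc β.surjective).obj X)
    (Units.val (tau d β hβc σ hσ X u))).mpr (hσint _ hu')

include hσ in
/-- **NATURALITY of `τ`** for the pull-back maps of `B₀` along a morphism `f : X' ⟶ X` of `CosetCat G_v` (point `β w · U_X`): both composites
send a unit `u` of `Ω^{U_X}` to `w • σ u` — `(F₁ f)^* u = β w • u`, `σ (β w • u) = w • σ u`, and `(F₂ f)^* = w • (−)` (`pt (pull β f) = w`,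
abc-iut-w4-d078 `pt_pull_map_coe`). [cite: MochizukiFrdII2008, Ex 1.3 (ii) p.11] -/
theorem tau_natural {X X' : CosetCat d.Gal} (f : X' ⟶ X) (u : ((baseFunctor₁ d).obj X).Kˣ) :
    tau d β hβc σ hσ X' (Units.map (((baseFunctor₁ d).map f).alg : ((baseFunctor₁ d).obj X).K →* ((baseFunctor₁ d).obj X').K) u) =
      Units.map (((baseFunctor₂ d β hβc).map f).alg : ((baseFunctor₂ d β hβc).obj X).K →* ((baseFunctor₂ d β hβc).obj X').K)
        (tau d β hβc σ hσ X u) := by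
  obtain ⟨a, ha⟩ := QuotientGroup.mk_surjective (CosetCat.pt f)
  obtain ⟨w, rfl⟩ := β.surjective a
  have hpull : CosetCat.pt ((CosetCat.pull (β : d.Gal →* d.Gal) hβc β.surjective).map f) =
      ((w : d.Gal) : ((CosetCat.pull (β : d.Gal →* d.Gal) hβc β.surjective).obj X).carrier) :=
    CosetCat.pt_pull_map_coe (β : d.Gal →* d.Gal) hβc β.surjective f ha.symm rfl
  apply SigmaLift.unitsVal_injective d
  have t1 := unitsVal_tau d β hβc σ hσ X'
    (Units.map (((baseFunctor₁ d).map f).alg : ((baseFunctor₁ d).obj X).K →* ((baseFunctor₁ d).obj X').K) u)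
  have t2 := unitsVal_tau d β hβc σ hσ X u
  have e₁ : SigmaLift.unitsVal d (d.fixedFld X')
      (Units.map (((baseFunctor₁ d).map f).alg : ((baseFunctor₁ d).obj X).K →* ((baseFunctor₁ d).obj X').K) u) =
      β w • SigmaLift.unitsVal d (d.fixedFld X) u := by
    apply Units.ext
    change ((d.fixedHom f (Units.val u) : ↥(d.fixedFld X')) : d.Ω) = (β w) ((Units.val u : ↥(d.fixedFld X)) : d.Ω)
    exact d.fixedHom_apply_coe _ _ ha.symm _
  have e₂ : SigmaLift.unitsVal d (d.fixedFld ((CosetCat.pull (β : d.Gal →* d.Gal) hβc β.surjective).obj X'))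
      (Units.map (((baseFunctor₂ d β hβc).map f).alg : ((baseFunctor₂ d β hβc).obj X).K →* ((baseFunctor₂ d β hβc).obj X').K)
        (tau d β hβc σ hσ X u)) =
      w • SigmaLift.unitsVal d (d.fixedFld ((CosetCat.pull (β : d.Gal →* d.Gal) hβc β.surjective).obj X)) (tau d β hβc σ hσ X u) := by
    apply Units.ext
    change ((d.fixedHom ((CosetCat.pull (β : d.Gal →* d.Gal) hβc β.surjective).map f) (Units.val (tau d β hβc σ hσ X u)) :
      ↥(d.fixedFld ((CosetCat.pull (β : d.Gal →* d.Gal) hβc β.surjective).obj X'))) : d.Ω) = _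
    exact d.fixedHom_apply_coe _ _ hpull _
  rw [e₁, hσ, MulEquiv.symm_apply_apply] at t1
  exact t1.trans ((congrArg (fun v : d.Ωˣ => w • v) t2.symm).trans e₂.symm)

/-- The restricted valuation of a fixed field `Ω^W` agrees with that of `Ω` on equalities (abc-iut-L5-t2 `valOn_iff`). [cite: MochizukiFrdII2008, Ex 1.1 (i) p.7] -/
theorem valuation_fixedFld_eq_iff (Y : CosetCat d.Gal) (x y : ↥(d.fixedFld Y)) :
    @ValuativeRel.valuation (↥(d.fixedFld Y)) _ (d.valOn (d.fixedFld Y)) x = @ValuativeRel.valuation (↥(d.fixedFld Y)) _ (d.valOn (d.fixedFld Y)) y ↔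
      ValuativeRel.valuation d.Ω (x : d.Ω) = ValuativeRel.valuation d.Ω (y : d.Ω) := by
  letI : ValuativeRel (↥(d.fixedFld Y)) := d.valOn (d.fixedFld Y)
  rw [le_antisymm_iff, le_antisymm_iff, ← Valuation.Compatible.vle_iff_le, ← Valuation.Compatible.vle_iff_le, d.valOn_iff, d.valOn_iff,
    Valuation.Compatible.vle_iff_le (v := ValuativeRel.valuation d.Ω), Valuation.Compatible.vle_iff_le (v := ValuativeRel.valuation d.Ω)]

include hσp in
/-- **`v(τ_X p) = v(p)`** in `Ω^{β⁻¹U}` (hypothesis `hσp` read through the restricted valuation). [cite: MochizukiFrdII2008, Thm 1.2 (v) p.9] -/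
theorem tau_p (X : CosetCat d.Gal) :
    ValuativeRel.valuation ((baseFunctor₂ d β hβc).obj X).K (tau d β hβc σ hσ X ((baseFunctor₁ d).obj X).primeUnit : ((baseFunctor₂ d β hβc).obj X).K) =
      ValuativeRel.valuation ((baseFunctor₂ d β hβc).obj X).K ((p : ℕ) : ((baseFunctor₂ d β hβc).obj X).K) :=
  (valuation_fixedFld_eq_iff d ((CosetCat.pull (β : d.Gal →* d.Gal) hβc β.surjective).obj X) _ _).mpr
    (hσp (SigmaLift.unitsVal d (d.fixedFld X) ((baseFunctor₁ d).obj X).primeUnit) rfl)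

end Tau

/-! ### §B. The data morphism over `pull β` at `𝒞⊢_v = (Datum.prim d.fieldFunctor …).frobenioid` from `(β, σ)` -/

section Lift

variable {p : ℕ} [Fact p.Prime] (d : GaloisValDatum.{u} p) (β : d.Gal ≃* d.Gal) (hβc : Continuous β)
  (σ : d.Ωˣ →* d.Ωˣ) (hσ : ∀ (γ : d.Gal) (x : d.Ωˣ), σ (γ • x) = β.symm γ • σ x)
  (hσint : ∀ x : d.Ωˣ, ValuativeRel.valuation d.Ω (x : d.Ω) ≤ 1 → ValuativeRel.valuation d.Ω (σ x : d.Ω) ≤ 1)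
  (hσp : ∀ x : d.Ωˣ, (x : d.Ω) = (p : ℕ) → ValuativeRel.valuation d.Ω (σ x : d.Ω) = ValuativeRel.valuation d.Ω ((p : ℕ) : d.Ω))

/-- The absolutely primitive datum of `𝒞⊢_v` over `𝒟⊢_v = CosetCat G_v` (abc-iut-L1 `Datum.prim` at abc-iut-L5-t2's field functor; `𝒞⊢_v` of
`GoodLocalFrobenioid.ofGalois d …` IS `(primDatum d).frobenioid`, rfl). [cite: MochizukiFrdII2008, Ex 1.1 (ii) p.8] -/
abbrev primDatum : PadicFrd.Datum (CosetCat d.Gal) p :=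
  PadicFrd.Datum.prim d.fieldFunctor d.fieldFunctor_isPadicLocal CosetCat.isConnected CosetCat.isTotallyEpimorphic

/-- **THE DATA MORPHISM OVER `pull β` induced by `(β, σ)`**: abc-iut-L5-t16's brick `PadicFrd.primMulTransport` at the base functors `d.fieldFunctor`
and `pull β ⋙ d.fieldFunctor` over `CosetCat G_v` — definitionally a `DataHomOver (pull β)` between `𝒞⊢_v`'s own absolutely primitive data.
[cite: MochizukiFrdI2008, Thm. 5.2(i) p.100] -/
def dataHomOver :
    ModelFrobenioid.DataHomOver (CosetCat.pull (β : d.Gal →* d.Gal) hβc β.surjective) (primDatum d).divB (primDatum d).divB :=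
  PadicFrd.primMulTransport (baseFunctor₁ d) (baseFunctor₂ d β hβc) d.fieldFunctor_isPadicLocal
    (GoodLocalFrobenioid.hlocOver (CosetCat.pull (β : d.Gal →* d.Gal) hβc β.surjective) d.fieldFunctor d.fieldFunctor_isPadicLocal)
    CosetCat.isConnected CosetCat.isTotallyEpimorphic (tau d β hβc σ hσ) (tau_integral d β hβc σ hσ hσint)
    (fun f u => tau_natural d β hβc σ hσ f u) (tau_p d β hβc σ hσ hσp)

/-! ### §C. The lift and its properties -/

/-- **THE MONO-ANALYTIC LIFT `Ψ⊢_{β,σ} : 𝒞⊢_v ⥤ 𝒞⊢_v`** (`(A, n·ord p) ↦ (β⁻¹A, n·ord p)`, units by `σ`, `p ↦ p`). ([IUTchI] Cor 5.3 (iii) p.144) [claim: Mochizuki2012, status: disputed] -/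
def lift : (primDatum d).frobenioid ⥤ (primDatum d).frobenioid :=
  (dataHomOver d β hβc σ hσ hσint hσp).functor

/-- **`Ψ⊢_{β,σ}` LIES OVER `pull β` ON THE NOSE** through `𝒞⊢_v → 𝒟⊢_v` (abc-iut-w5-d048 `DataHomOver.functor_comp_baseFunctor`).
([IUTchI] Cor 5.3 (iii) p.144) [claim: Mochizuki2012, status: disputed] -/
theorem lift_comp_CdashBase :
    lift d β hβc σ hσ hσint hσp ⋙
        PadicFrd.GoodLocalKit.CdashBase d.fieldFunctor d.fieldFunctor_isPadicLocal CosetCat.isConnected CosetCat.isTotallyEpimorphic =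
      PadicFrd.GoodLocalKit.CdashBase d.fieldFunctor d.fieldFunctor_isPadicLocal CosetCat.isConnected CosetCat.isTotallyEpimorphic ⋙
        CosetCat.pull (β : d.Gal →* d.Gal) hβc β.surjective :=
  (dataHomOver d β hβc σ hσ hσint hσp).functor_comp_baseFunctor

variable (hβc' : Continuous β.symm) (σ' : d.Ωˣ →* d.Ωˣ) (hσ' : ∀ (γ : d.Gal) (x : d.Ωˣ), σ' (γ • x) = β γ • σ' x)
  (hσ'int : ∀ x : d.Ωˣ, ValuativeRel.valuation d.Ω (x : d.Ω) ≤ 1 → ValuativeRel.valuation d.Ω (σ' x : d.Ω) ≤ 1)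
  (hσ'p : ∀ x : d.Ωˣ, (x : d.Ω) = (p : ℕ) → ValuativeRel.valuation d.Ω (σ' x : d.Ω) = ValuativeRel.valuation d.Ω ((p : ℕ) : d.Ω))
  (hinv : ∀ x, σ' (σ x) = x) (hinv' : ∀ x, σ (σ' x) = x)

/-- `β ∘ β⁻¹ = id` as monoid homomorphisms. [folklore] -/
private theorem comp_symm_eq_id : (β : d.Gal →* d.Gal).comp (β.symm : d.Gal →* d.Gal) = MonoidHom.id _ := MonoidHom.ext β.apply_symm_apply

/-- `β⁻¹ ∘ β = id` as monoid homomorphisms. [folklore] -/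
private theorem symm_comp_eq_id : (β.symm : d.Gal →* d.Gal).comp (β : d.Gal →* d.Gal) = MonoidHom.id _ := MonoidHom.ext β.symm_apply_apply

include hσ' in
/-- The inverse family `τ'_X = σ'|` maps units of `Ω^{β⁻¹U}` back into `Ω^U` (`σ'` is `β`-equivariant). [cite: Mochizuki2012, I Ex 3.3 (i) p.78] -/
theorem sigma'_mem_fixedFld (X : CosetCat d.Gal) (u : (↥(d.fixedFld ((CosetCat.pull (β : d.Gal →* d.Gal) hβc β.surjective).obj X)))ˣ) :
    (σ' (SigmaLift.unitsVal d (d.fixedFld ((CosetCat.pull (β : d.Gal →* d.Gal) hβc β.surjective).obj X)) u) : d.Ω) ∈ d.fixedFld X := by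
  refine (IntermediateField.mem_fixedField_iff _ _).mpr fun g hg => ?_
  have hg' : β.symm g ∈ ((CosetCat.pull (β : d.Gal →* d.Gal) hβc β.surjective).obj X).sg := by
    change β (β.symm g) ∈ X.sg
    rw [MulEquiv.apply_symm_apply]; exact hg
  have hfix : β.symm g • (SigmaLift.unitsVal d (d.fixedFld ((CosetCat.pull (β : d.Gal →* d.Gal) hβc β.surjective).obj X)) u) =
      SigmaLift.unitsVal d (d.fixedFld ((CosetCat.pull (β : d.Gal →* d.Gal) hβc β.surjective).obj X)) u := by
    apply Units.ext
    change (β.symm g) ((u : ↥(d.fixedFld ((CosetCat.pull (β : d.Gal →* d.Gal) hβc β.surjective).obj X))) : d.Ω) = _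
    exact (IntermediateField.mem_fixedField_iff _ _).mp
      (u : ↥(d.fixedFld ((CosetCat.pull (β : d.Gal →* d.Gal) hβc β.surjective).obj X))).2 _ hg'
  have key := hσ' (β.symm g) (SigmaLift.unitsVal d (d.fixedFld ((CosetCat.pull (β : d.Gal →* d.Gal) hβc β.surjective).obj X)) u)
  rw [hfix, MulEquiv.apply_symm_apply] at key
  exact (congrArg (fun w : d.Ωˣ => (w : d.Ω)) key).symm

/-- The inverse family `τ'`. [cite: Mochizuki2012, I Ex 3.3 (i) p.78] -/
def tau' (X : CosetCat d.Gal) : ((baseFunctor₂ d β hβc).obj X).Kˣ →* ((baseFunctor₁ d).obj X).Kˣ :=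
  SigmaLift.fixedUnitsMap d σ' _ _ (sigma'_mem_fixedFld d β hβc σ' hσ' X)

include hσ'int in
/-- `τ'` carries integral units to integral units. [cite: MochizukiFrdII2008, Ex 1.1 (i) p.7] -/
theorem tau'_integral (X : CosetCat d.Gal) (u : ((baseFunctor₂ d β hβc).obj X).Kˣ)
    (hu : ValuativeRel.valuation ((baseFunctor₂ d β hβc).obj X).K (u : ((baseFunctor₂ d β hβc).obj X).K) ≤ 1) :
    ValuativeRel.valuation ((baseFunctor₁ d).obj X).K (tau' d β hβc σ' hσ' X u : ((baseFunctor₁ d).obj X).K) ≤ 1 := by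
  have hu' : ValuativeRel.valuation d.Ω
      ((SigmaLift.unitsVal d (d.fixedFld ((CosetCat.pull (β : d.Gal →* d.Gal) hβc β.surjective).obj X)) u : d.Ωˣ) : d.Ω) ≤ 1 :=
    (SigmaLift.valuation_fieldObj_le_one_iff d ((CosetCat.pull (β : d.Gal →* d.Gal) hβc β.surjective).obj X) (Units.val u)).mp hu
  exact (SigmaLift.valuation_fieldObj_le_one_iff d X (Units.val (tau' d β hβc σ' hσ' X u))).mpr (hσ'int _ hu')

include hσ'p in
/-- `v(τ'_X p) = v(p)` in `Ω^U`. [cite: MochizukiFrdII2008, Thm 1.2 (v) p.9] -/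
theorem tau'_p (X : CosetCat d.Gal) :
    ValuativeRel.valuation ((baseFunctor₁ d).obj X).K (tau' d β hβc σ' hσ' X ((baseFunctor₂ d β hβc).obj X).primeUnit : ((baseFunctor₁ d).obj X).K) =
      ValuativeRel.valuation ((baseFunctor₁ d).obj X).K ((p : ℕ) : ((baseFunctor₁ d).obj X).K) :=
  (valuation_fixedFld_eq_iff d X _ _).mpr
    (hσ'p (SigmaLift.unitsVal d (d.fixedFld ((CosetCat.pull (β : d.Gal →* d.Gal) hβc β.surjective).obj X))
      ((baseFunctor₂ d β hβc).obj X).primeUnit) rfl)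

include hinv in
/-- `τ' ∘ τ = id`. [cite: Mochizuki2012, I Ex 3.3 (i) p.78] -/
theorem tau'_tau (X : CosetCat d.Gal) (u : ((baseFunctor₁ d).obj X).Kˣ) : tau' d β hβc σ' hσ' X (tau d β hβc σ hσ X u) = u := by
  apply SigmaLift.unitsVal_injective d
  change SigmaLift.unitsVal d _ (SigmaLift.fixedUnitsMap d σ' _ _ _ (SigmaLift.fixedUnitsMap d σ _ _ _ u)) = _
  rw [SigmaLift.unitsVal_fixedUnitsMap, SigmaLift.unitsVal_fixedUnitsMap, hinv]

include hinv' in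
/-- `τ ∘ τ' = id`. [cite: Mochizuki2012, I Ex 3.3 (i) p.78] -/
theorem tau_tau' (X : CosetCat d.Gal) (u : ((baseFunctor₂ d β hβc).obj X).Kˣ) : tau d β hβc σ hσ X (tau' d β hβc σ' hσ' X u) = u := by
  apply SigmaLift.unitsVal_injective d
  change SigmaLift.unitsVal d _ (SigmaLift.fixedUnitsMap d σ _ _ _ (SigmaLift.fixedUnitsMap d σ' _ _ _ u)) = _
  rw [SigmaLift.unitsVal_fixedUnitsMap, SigmaLift.unitsVal_fixedUnitsMap, hinv']

include hβc' σ' hσ' hσ'int hσ'p hinv hinv' in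
/-- **`Ψ⊢_{β,σ}` is an EQUIVALENCE** when `σ` has an integral `β`-equivariant inverse `σ'` of the same valuation at `p` ([FrdI] Cor 5.4: abc-iut-w5-d137
`functor_isEquivalence` over the equivalence `pull β`; the `η`-components are bijective for free, the `β`-components by the brick's
`primMulTransportβ_bijective`). [cite: MochizukiFrdI2008, Cor. 5.4 p.104] -/
theorem lift_isEquivalence : (lift d β hβc σ hσ hσint hσp).IsEquivalence := by
  haveI : (CosetCat.pull (β : d.Gal →* d.Gal) hβc β.surjective).IsEquivalence :=
    (PiTransport.pullSelfEquiv (β : d.Gal →* d.Gal) (β.symm : d.Gal →* d.Gal) hβc hβc' (comp_symm_eq_id d β)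
      (symm_comp_eq_id d β)).isEquivalence_functor
  refine (dataHomOver d β hβc σ hσ hσint hσp).functor_isEquivalence (fun X => ?_) (fun X => ?_)
  · exact PadicFrd.primMulTransportη_bijective (baseFunctor₁ d) (baseFunctor₂ d β hβc) d.fieldFunctor_isPadicLocal
      (GoodLocalFrobenioid.hlocOver (CosetCat.pull (β : d.Gal →* d.Gal) hβc β.surjective) d.fieldFunctor d.fieldFunctor_isPadicLocal)
      CosetCat.isConnected CosetCat.isTotallyEpimorphic (tau d β hβc σ hσ) (tau_integral d β hβc σ hσ hσint)
      (fun f u => tau_natural d β hβc σ hσ f u) (tau_p d β hβc σ hσ hσp) (op X)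
  · exact PadicFrd.primMulTransportβ_bijective (baseFunctor₁ d) (baseFunctor₂ d β hβc) d.fieldFunctor_isPadicLocal
      (GoodLocalFrobenioid.hlocOver (CosetCat.pull (β : d.Gal →* d.Gal) hβc β.surjective) d.fieldFunctor d.fieldFunctor_isPadicLocal)
      (tau d β hβc σ hσ) (tau' d β hβc σ' hσ') (tau_integral d β hβc σ hσ hσint) (tau'_integral d β hβc σ' hσ' hσ'int)
      (tau_p d β hβc σ hσ hσp) (tau'_p d β hβc σ' hσ' hσ'p) (tau'_tau d β hβc σ hσ σ' hσ' hinv) (tau_tau' d β hβc σ hσ σ' hσ' hinv') (op X)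

include hβc' σ' hσ' hσ'int hσ'p hinv hinv' in
/-- **THE MONO-ANALYTIC LIFT AT THE REAL `𝒞⊢_v`**: for every `β ∈ Aut(G_v)` (continuous with continuous inverse) and every `β⁻¹`-equivariant
integral multiplicative `σ : K̄_vˣ ⥲ K̄_vˣ` of the same valuation at `p` (integral inverse `σ'`), there is a self-equivalence of
`𝒞⊢_v = (Datum.prim d.fieldFunctor …).frobenioid` (functor THE lift) LYING UNDER the transport `pullSelfEquiv β β⁻¹` of `ℬ(G_v)⁰` through `𝒞⊢_v → 𝒟⊢_v`
— print's route to Cor 5.3 (iii) through [AbsTopIII] Prop 5.8 (ii), as a THEOREM about abc-iut-L5-t2's construction once `σ` is given.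
([IUTchI] Cor 5.3 (iii) p.144) [claim: Mochizuki2012, status: disputed] -/
theorem exists_selfEquivalence_liesUnder_pullSelfEquiv :
    ∃ Ψ : (primDatum d).frobenioid ≌ (primDatum d).frobenioid, Ψ.functor = lift d β hβc σ hσ hσint hσp ∧
      Nonempty (CatIsomorphism.LiesUnder
        (PadicFrd.GoodLocalKit.CdashBase d.fieldFunctor d.fieldFunctor_isPadicLocal CosetCat.isConnected CosetCat.isTotallyEpimorphic)
        (PadicFrd.GoodLocalKit.CdashBase d.fieldFunctor d.fieldFunctor_isPadicLocal CosetCat.isConnected CosetCat.isTotallyEpimorphic)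
        Ψ (PiTransport.pullSelfEquiv (β : d.Gal →* d.Gal) (β.symm : d.Gal →* d.Gal) hβc hβc' (comp_symm_eq_id d β) (symm_comp_eq_id d β))) := by
  haveI := lift_isEquivalence d β hβc σ hσ hσint hσp hβc' σ' hσ' hσ'int hσ'p hinv hinv'
  refine ⟨(lift d β hβc σ hσ hσint hσp).asEquivalence, rfl, ⟨?_⟩⟩
  change lift d β hβc σ hσ hσint hσp ⋙
      PadicFrd.GoodLocalKit.CdashBase d.fieldFunctor d.fieldFunctor_isPadicLocal CosetCat.isConnected CosetCat.isTotallyEpimorphic ≅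
    PadicFrd.GoodLocalKit.CdashBase d.fieldFunctor d.fieldFunctor_isPadicLocal CosetCat.isConnected CosetCat.isTotallyEpimorphic ⋙
      CosetCat.pull (β : d.Gal →* d.Gal) hβc _
  exact eqToIso (lift_comp_CdashBase d β hβc σ hσ hσint hσp)

include hβc' σ' hσ' hσ'int hσ'p hinv hinv' in
/-- **The same AT abc-iut-L5-t2's record `GoodLocalFrobenioid.ofGalois d aug …`** (any `Π_v ↠ G_v`, any `K_v ∋ p_v`): its `𝒞⊢_v → 𝒟⊢_v` IS the
absolutely primitive Frobenioid over `CosetCat G_v` (`ofKit_C`, rfl), so every `(β, σ)` as above gives a self-equivalence of `(ofGalois …).Cdash`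
lying under `pullSelfEquiv β β⁻¹` through `(ofGalois …).CdashBase`. ([IUTchI] Cor 5.3 (iii) p.144) [claim: Mochizuki2012, status: disputed] -/
theorem exists_selfEquivalence_liesUnder_ofGalois {P : Type u} [Group P] [TopologicalSpace P] (aug : P →* d.Gal) (hc : Continuous aug)
    (hs : Function.Surjective aug) (ho : IsOpenMap aug) (Kv : Type) [Field Kv] [ValuativeRel Kv] (hp : ((p : Kv)) ∈ PadicFrd.intNonzero Kv) :
    ∃ Ψ : (GoodLocalFrobenioid.ofGalois d aug hc hs ho Kv hp).Cdash ≌ (GoodLocalFrobenioid.ofGalois d aug hc hs ho Kv hp).Cdash,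
      Ψ.functor = lift d β hβc σ hσ hσint hσp ∧
      Nonempty (CatIsomorphism.LiesUnder (GoodLocalFrobenioid.ofGalois d aug hc hs ho Kv hp).CdashBase
        (GoodLocalFrobenioid.ofGalois d aug hc hs ho Kv hp).CdashBase Ψ
        (PiTransport.pullSelfEquiv (β : d.Gal →* d.Gal) (β.symm : d.Gal →* d.Gal) hβc hβc' (comp_symm_eq_id d β) (symm_comp_eq_id d β))) :=
  exists_selfEquivalence_liesUnder_pullSelfEquiv d β hβc σ hσ hσint hσp hβc' σ' hσ' hσ'int hσ'p hinv hinv'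

/-! ### §D. The lift carries `τ⊢_v` to `τ⊢_v` (an automorphism of the SPLIT Frobenioid `ℱ⊢_v = (𝒞⊢_v, τ⊢_v)`) -/

/-- `u ↦ u|_{K^×}` on the powers of the distinguished element `p̂ = (p, ord p)` of `B⊢(A)`: `p̂^m ↦ p^m`. [cite: MochizukiFrdII2008, Thm 1.2 (v) p.10] -/
theorem resK_primLiftP_pow (A : CosetCat d.Gal) (m : ℕ) :
    (primDatum d).resK A (PadicFrd.primLiftP d.fieldFunctor (op A) ^ m) = (d.fieldFunctor.obj A).primeUnit ^ m :=
  (map_pow ((primDatum d).resK A) (PadicFrd.primLiftP d.fieldFunctor (op A)) m).trans rfl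

/-- **`H`, forward**: if a base-identity linear endomorphism `w` of `A` has rational function `p^m`, so does `Ψ⊢ w` — `u_w = p̂^m`
(abc-iut-L5-t16 gen 7 `resK_injective`), `u_{Ψ⊢ w} = β_A(u_w) = β_A(p̂)^m = p̂^m` (the brick's `primMulTransportβ_primLiftP`).
[cite: MochizukiFrdII2008, Thm 1.2 (v) p.10] -/
theorem resK_unit_lift_map_eq {X : (primDatum d).frobenioid} (w : X ⟶ X) (m : ℕ)
    (hw : (primDatum d).resK X.base (ModelFrobenioid.unit w) = (d.fieldFunctor.obj X.base).primeUnit ^ m) :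
    (primDatum d).resK ((CosetCat.pull (β : d.Gal →* d.Gal) hβc β.surjective).obj X.base)
        (ModelFrobenioid.unit ((lift d β hβc σ hσ hσint hσp).map w)) =
      (d.fieldFunctor.obj ((CosetCat.pull (β : d.Gal →* d.Gal) hβc β.surjective).obj X.base)).primeUnit ^ m := by
  have hu : (ModelFrobenioid.unit w : ↥(PadicFrd.primBSub (baseFunctor₁ d) (op X.base))) = PadicFrd.primLiftP (baseFunctor₁ d) (op X.base) ^ m :=
    (primDatum d).resK_injective X.base (hw.trans (resK_primLiftP_pow d X.base m).symm)
  have h1 : ModelFrobenioid.unit ((lift d β hβc σ hσ hσint hσp).map w) =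
      PadicFrd.primMulTransportβ (baseFunctor₁ d) (baseFunctor₂ d β hβc) d.fieldFunctor_isPadicLocal
        (GoodLocalFrobenioid.hlocOver (CosetCat.pull (β : d.Gal →* d.Gal) hβc β.surjective) d.fieldFunctor d.fieldFunctor_isPadicLocal)
        (tau d β hβc σ hσ) (tau_integral d β hβc σ hσ hσint) (tau_p d β hβc σ hσ hσp) (op X.base) (ModelFrobenioid.unit w) :=
    (dataHomOver d β hβc σ hσ hσint hσp).unit_functor_map w
  rw [h1, hu, map_pow, PadicFrd.primMulTransportβ_primLiftP]
  exact resK_primLiftP_pow d ((CosetCat.pull (β : d.Gal →* d.Gal) hβc β.surjective).obj X.base) m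

include σ' hσ' hσ'int hσ'p hinv in
/-- **`H`, backward**: if `Ψ⊢ w` has rational function `p^m`, so does `w` — apply the inverse component `β'_A` (from `σ'`), which also fixes `p̂`.
[cite: MochizukiFrdII2008, Thm 1.2 (v) p.10] -/
theorem resK_unit_eq_of_lift_map {X : (primDatum d).frobenioid} (w : X ⟶ X) (m : ℕ)
    (hw' : (primDatum d).resK ((CosetCat.pull (β : d.Gal →* d.Gal) hβc β.surjective).obj X.base)
        (ModelFrobenioid.unit ((lift d β hβc σ hσ hσint hσp).map w)) =
      (d.fieldFunctor.obj ((CosetCat.pull (β : d.Gal →* d.Gal) hβc β.surjective).obj X.base)).primeUnit ^ m) :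
    (primDatum d).resK X.base (ModelFrobenioid.unit w) = (d.fieldFunctor.obj X.base).primeUnit ^ m := by
  have h1 : ModelFrobenioid.unit ((lift d β hβc σ hσ hσint hσp).map w) =
      PadicFrd.primMulTransportβ (baseFunctor₁ d) (baseFunctor₂ d β hβc) d.fieldFunctor_isPadicLocal
        (GoodLocalFrobenioid.hlocOver (CosetCat.pull (β : d.Gal →* d.Gal) hβc β.surjective) d.fieldFunctor d.fieldFunctor_isPadicLocal)
        (tau d β hβc σ hσ) (tau_integral d β hβc σ hσ hσint) (tau_p d β hβc σ hσ hσp) (op X.base) (ModelFrobenioid.unit w) :=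
    (dataHomOver d β hβc σ hσ hσint hσp).unit_functor_map w
  -- `β_A(u_w) = p̂^m` by injectivity of `u ↦ u|_{K^×}` at the object `β⁻¹A`
  have e1 : (PadicFrd.primMulTransportβ (baseFunctor₁ d) (baseFunctor₂ d β hβc) d.fieldFunctor_isPadicLocal
        (GoodLocalFrobenioid.hlocOver (CosetCat.pull (β : d.Gal →* d.Gal) hβc β.surjective) d.fieldFunctor d.fieldFunctor_isPadicLocal)
        (tau d β hβc σ hσ) (tau_integral d β hβc σ hσ hσint) (tau_p d β hβc σ hσ hσp) (op X.base) (ModelFrobenioid.unit w) :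
          ↥(PadicFrd.primBSub (baseFunctor₂ d β hβc) (op X.base))) =
      PadicFrd.primLiftP (baseFunctor₂ d β hβc) (op X.base) ^ m := by
    refine (primDatum d).resK_injective ((CosetCat.pull (β : d.Gal →* d.Gal) hβc β.surjective).obj X.base) ?_
    rw [← h1]
    exact hw'.trans (resK_primLiftP_pow d ((CosetCat.pull (β : d.Gal →* d.Gal) hβc β.surjective).obj X.base) m).symm
  -- apply the inverse component `β'_A`
  have e2 : (ModelFrobenioid.unit w : ↥(PadicFrd.primBSub (baseFunctor₁ d) (op X.base))) = PadicFrd.primLiftP (baseFunctor₁ d) (op X.base) ^ m := by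
    rw [← PadicFrd.primMulTransportβ_leftInverse (baseFunctor₁ d) (baseFunctor₂ d β hβc) d.fieldFunctor_isPadicLocal
      (GoodLocalFrobenioid.hlocOver (CosetCat.pull (β : d.Gal →* d.Gal) hβc β.surjective) d.fieldFunctor d.fieldFunctor_isPadicLocal)
      (tau d β hβc σ hσ) (tau' d β hβc σ' hσ') (tau_integral d β hβc σ hσ hσint) (tau'_integral d β hβc σ' hσ' hσ'int)
      (tau_p d β hβc σ hσ hσp) (tau'_p d β hβc σ' hσ' hσ'p) (tau'_tau d β hβc σ hσ σ' hσ' hinv) (op X.base) (ModelFrobenioid.unit w),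
      e1, map_pow, PadicFrd.primMulTransportβ_primLiftP]
  rw [e2]
  exact resK_primLiftP_pow d X.base m

include hβc' hσ' hσ'int hσ'p hinv hinv' in
/-- **THE LIFT CARRIES `τ⊢_v` TO `τ⊢_v`**: for every object `A` of `𝒞⊢_v`, `Ψ⊢_{β,σ}` maps the characteristic splitting `τ_p(A)` ([FrdII]
Thm 1.2 (v); abc-iut-L1 `pSplittingSubmonoid`) ONTO `τ_p(Ψ⊢ A)` — abc-iut-L5-t16 gen 7's transport criterion `map_pSplittingSubmonoid_eq_of_units`
with base data `(pull β, lift_comp_CdashBase)` and `H` = the two lemmas above.  So the lift is an automorphism of the SPLIT Frobenioid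
`ℱ⊢_v = (𝒞⊢_v, τ⊢_v)`, as an isomorphism of `ℱ⊢`-prime-strips must be ([IUTchI] Def 5.2 (ii)). ([IUTchI] Cor 5.3 (iii) p.144) [claim: Mochizuki2012, status: disputed] -/
theorem map_pSplittingSubmonoid_lift (X : (primDatum d).frobenioid) :
    ((primDatum d).pSplittingSubmonoid X).map ((lift d β hβc σ hσ hσint hσp).mapEnd X) =
      (primDatum d).pSplittingSubmonoid ((lift d β hβc σ hσ hσint hσp).obj X) := by
  haveI := lift_isEquivalence d β hβc σ hσ hσint hσp hβc' σ' hσ' hσ'int hσ'p hinv hinv'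
  haveI : (CosetCat.pull (β : d.Gal →* d.Gal) hβc β.surjective).Faithful := CosetCat.pull_faithful _ _ _
  exact (primDatum d).map_pSplittingSubmonoid_eq_of_units (lift d β hβc σ hσ hσint hσp).asEquivalence
    (CosetCat.pull (β : d.Gal →* d.Gal) hβc β.surjective) (eqToIso (lift_comp_CdashBase d β hβc σ hσ hσint hσp)) (fun _ _ _ => rfl)
    (fun Y w _ m => ⟨resK_unit_lift_map_eq d β hβc σ hσ hσint hσp w m,
      resK_unit_eq_of_lift_map d β hβc σ hσ hσint hσp σ' hσ' hσ'int hσ'p hinv w m⟩) X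

include hβc' hσ' hσ'int hσ'p hinv hinv' in
/-- **The same in abc-iut-L5-t2's vocabulary** (`S3Local.CharSplitting.IsPreservedBy`, `SplitFrobenioids.lean`): at the record
`GoodLocalFrobenioid.ofGalois d aug …` (any `Π_v ↠ G_v`), whose `τ⊢_v` IS `τ_p` of the absolutely primitive datum (`ofKit_tauDash`, rfl), the
lift PRESERVES `τ⊢_v`. ([IUTchI] Cor 5.3 (iii) p.144) [claim: Mochizuki2012, status: disputed] -/
theorem isPreservedBy_tauDash_lift {P : Type u} [Group P] [TopologicalSpace P] (aug : P →* d.Gal) (hc : Continuous aug)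
    (hs : Function.Surjective aug) (ho : IsOpenMap aug) (Kv : Type) [Field Kv] [ValuativeRel Kv] (hp : ((p : Kv)) ∈ PadicFrd.intNonzero Kv) :
    (GoodLocalFrobenioid.ofGalois d aug hc hs ho Kv hp).tauDash.IsPreservedBy (GoodLocalFrobenioid.ofGalois d aug hc hs ho Kv hp).tauDash
      (lift d β hβc σ hσ hσint hσp) :=
  fun X => map_pSplittingSubmonoid_lift d β hβc σ hσ hσint hσp hβc' σ' hσ' hσ'int hσ'p hinv hinv' X

end Lift

end DashSigmaLift

end Literature.IUT.HodgeTheaters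

end
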